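import Summits.NavierStokesRegularity.NavierStokesRegularity.Theorems.ScenarioCensusRowF1SymmetricTopTransfer
import Summits.NavierStokesRegularity.NavierStokesRegularity.Theorems.SymmetricLiouville.Negative.ScrewClause
import HarnessLib

/-!
# LINE 33 «symmetric-top» port, part 3/3: §5 the rows are EXCLUDED (`rowF1kt_holds`, `rowF1ks_holds`, `rowF1sy_holds`), the floor (`rigidMotionsBreak_holds`), the residual is
# exactly `Row_F1`; §6 anchors and ORDER LEMMAS (the axisymmetric census scenario, LINE 15's columnar top restated VERBATIM: `rowF1co_of_rowF1kt`); census KEYS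
# `Row_F1sy` / `Row_F1ks` / `Row_F1kt` + `_excluded`, floor RMB, edges

Re-homed for the scenario census (typer seat ns-census-typer-1 g9; the cells F1sy / F1ks / F1kt and the floor are MEMBERS OF RECORD «DECIDED IN KERNEL IN FILES» of row F1
since census v1.97 (item 67: critic idea-crit-3 PASS; ref PRE-CHECK ✓; lead-presearch label); this port makes them TREE-decided): VERBATIM PORT of ns-idea-3 LINE 33
«symmetric-top», `pub/ideators/ns-idea-3/lines/symmetric-top/line-symmetric-top.lean` sha16 b59608429eb1d133 (901 l., lean check rc 0, 0 sorry), split for the 400-line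
rule into `ScenarioCensusRowF1SymmetricTop` (§1–§3) → `…SymmetricTopTransfer` (§4) → `…SymmetricTopRows` (§5–§6 + census KEYS).  Lean text VERBATIM in namespace
`…Theorems.ScenarioCensus.SymmetricTop` (the line's `…Cruxes.ScenarioCensusRowF1.SymmetricTopLine` re-homed); port edits: §2's zoom package / `tendsto_physicalTime` / `isOpen_ne_zero` are the landed columnar-top port's, taken BY
NAME (`ColumnarTop.…`); §6 keeps the line's VERBATIM restatement of LINE 15's `HasColumnarTop` / `Row_F1co` for the order lemma (the census key `Row_F1co` is the
columnar-top port's); `@[conjecture]` on the residual `SymmetricCollapse` (≡ `ScenarioCensus.Row_F1`, OPEN); three one-line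
docstrings added (gate lint); §6's `isSkew_rotGenL` is the tree's `SymmetricLiouville.Negative.isSkew_rotGenL` (ScrewClause), taken BY NAME (gate lint dedup.landed; the two `IsSkew` predicates agree definitionally).  Statements untouched.

No census VALUE is moved here (row F1 stays OPEN-WITH-LINE; the members become TREE-decided by name); NS regularity is NOT proved; `Row_F1` is untouched (zero
movement, `symmetricCollapse_iff_rowF1`); no summit statement is proved by this file. Lemmas that restate already-landed tree declarations are taken BY NAME (gate lint `dedup.landed`): `exists_singularZoom_package` = `ColumnarTop.exists_singularZoom_package`, `tendsto_physicalTime` = `ColumnarTop.tendsto_physicalTime`, `isOpen_ne_zero` = `ColumnarTop.isOpen_ne_zero`, `isSkew_rotGenL` = `SymmetricLiouville.Negative.isSkew_rotGenL`.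
-/

-- the summit and its single problem share the name `NavierStokesRegularity` (D-0017 nested layout)
set_option linter.dupNamespace false

noncomputable section

open MeasureTheory Set Function Filter TopologicalSpace Metric
open scoped Topology NNReal ENNReal InnerProductSpace RealInnerProductSpace

namespace Summit.NavierStokesRegularity.NavierStokesRegularity.Theorems.ScenarioCensus.SymmetricTop

open Literature.Analysis Literature.Analysis.FluidPDE
open Summit.NavierStokesRegularity.NavierStokesRegularity.Theorems
open Summit.NavierStokesRegularity.NavierStokesRegularity.Theses

/-! ## §5 The rows are EXCLUDED; the floor; the residual is exactly `Row_F1` -/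

/-- **Criterion row F1kt is EXCLUDED** (in kernel): Type I + an almost symmetric top ⇒ extension. -/
theorem rowF1kt_holds : Row_F1kt := by
  intro ν T hν hT u p hsol hLH hdec hTI hsy
  obtain ⟨a, A, hA, hne0, hslack⟩ := hsy
  apply hasSmoothExtensionPast_of_forall_exists_parabolicCylinder hν hT hsol hLH hdec
  intro x₀
  by_contra hno
  have hsing : ∀ r : ℝ, 0 < r →
      eLpNorm (uncurry u) ∞ (volume.restrict (parabolicCylinder r ((T : ℝ), x₀))) = ∞ := by
    intro r hr
    by_contra h
    exact hno ⟨r, hr, lt_top_iff_ne_top.2 h⟩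
  obtain ⟨C, α, β, R, c, W, hα, hβ, hR, hcpos, hclim, hW, hpt, hgrad, t, ht, y, hne⟩ :=
    ColumnarTop.exists_singularZoom_package hν hT hsol hLH hdec hTI x₀ hsing
  exact hne (eq_zero_of_killingSlackTop hν hα hβ hR hcpos hclim hW hpt hgrad hA hne0 hslack t ht y)

/-- **Criterion row F1ks is EXCLUDED** (corollary). -/
theorem rowF1ks_holds : Row_F1ks := rowF1ks_of_rowF1kt rowF1kt_holds

/-- **Criterion row F1sy is EXCLUDED** (corollary; the `ε = 0` anchor). -/
theorem rowF1sy_holds : Row_F1sy := rowF1sy_of_rowF1ks rowF1ks_holds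

/-- **RIGID MOTIONS BREAK ON THE TOP** (structural theorem, in kernel). -/
theorem rigidMotionsBreak_holds : RigidMotionsBreak :=
  fun ν T hν hT u p hmax hLH hdec hTI a A hA hne h =>
    hmax.2 (rowF1kt_holds ν T hν hT u p hmax.1 hLH hdec hTI ⟨a, A, hA, hne, h⟩)

/-- No maximal Type-I Clay blow-up has an almost symmetric top / end / a symmetric end. -/
theorem not_hasAlmostSymmetricTop_of_typeI : ∀ (ν T : ℝ), 0 < ν → 0 < T →
    ∀ (u : ℝ → E3 → E3) (p : ℝ → E3 → ℝ),
    IsMaximalSmoothSolution ν 0 u p T → IsLerayHopfOn T ν 0 (u 0) u →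
    HasRapidSpatialDecay (u 0) → IsTypeIBlowup u T →
    ¬ HasAlmostSymmetricTop ν T u ∧ ¬ HasAlmostSymmetricEnd ν T u ∧ ¬ HasSymmetricEnd T u := by
  intro ν T hν hT u p hmax hLH hdec hTI
  have h1 : ¬ HasAlmostSymmetricTop ν T u := fun h =>
    hmax.2 (rowF1kt_holds ν T hν hT u p hmax.1 hLH hdec hTI h)
  exact ⟨h1, fun h => h1 h.hasAlmostSymmetricTop, fun h => h1 h.hasAlmostSymmetricEnd.hasAlmostSymmetricTop⟩

/-- **RIGID MOTIONS BREAK, unfolded** (display form): at a maximal Type-I Clay blow-up, for EVERY nonzero Killing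
generator `(a, A)` there are a level `Λ > 0` and an `ε > 0` such that for every `t₁ < T` some time `t ∈ (t₁, T)`
has a point of the top `{√(T−t)|u| ≥ Λ√ν}` where `(T − t) |Du·(a + Ax) − Au| > ε (|a + Ax| + √(ν(T−t))‖A‖)` —
the top is sheared / swirled off every rigid symmetry at the full Type-I rate, arbitrarily close to `T`. -/
theorem rigidMotionsBreak_unfolded : ∀ (ν T : ℝ), 0 < ν → 0 < T →
    ∀ (u : ℝ → E3 → E3) (p : ℝ → E3 → ℝ),
    IsMaximalSmoothSolution ν 0 u p T → IsLerayHopfOn T ν 0 (u 0) u →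
    HasRapidSpatialDecay (u 0) → IsTypeIBlowup u T →
    ∀ (a : E3) (A : E3 →L[ℝ] E3), IsSkew A → ¬ (a = 0 ∧ A = 0) →
    ∃ Λ : ℝ, 0 < Λ ∧ ∃ ε : ℝ, 0 < ε ∧ ∀ t₁ < T, ∃ t ∈ Ioo t₁ T, ∃ x : E3,
      Λ * Real.sqrt ν ≤ Real.sqrt (T - t) * ‖u t x‖ ∧
      ε * killingSize ν T a A t x < (T - t) * ‖killingDefect a A (u t) x‖ := by
  intro ν T hν hT u p hmax hLH hdec hTI a A hA hne
  have h := rigidMotionsBreak_holds ν T hν hT u p hmax hLH hdec hTI a A hA hne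
  by_contra hcon
  apply h
  intro Λ hΛ ε hε
  by_contra hev
  apply hcon
  refine ⟨Λ, hΛ, ε, hε, fun t₁ ht₁ => ?_⟩
  by_contra hno
  push Not at hno
  exact hev (eventually_of_mem (Ioo_mem_nhdsLT ht₁) fun t ht x hx => hno t ht x hx)

/-- **Row F1 ≡ SymmetricCollapse** (exact reformulation, in kernel). -/
theorem symmetricCollapse_iff_rowF1 : SymmetricCollapse ↔ ScenarioCensus.Row_F1 :=
  ⟨fun h => rowF1_of rowF1kt_holds h, symmetricCollapse_of_rowF1⟩

/-- **Composition concluding the target BY NAME**: `SymmetricCollapse → Row_F1`. -/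
theorem rowF1_of_symmetricCollapse : SymmetricCollapse → ScenarioCensus.Row_F1 :=
  symmetricCollapse_iff_rowF1.1

/-! ## §6 Anchors and ORDER LEMMAS: the axisymmetric census scenario (row F2, Type-I branch, Clay frame) and
LINE 15 «columnar-top» are the `ε = 0` rotation stratum and (a weakening of) the translation stratum of row F1kt -/

-- `isSkew_rotGenL`: the line restates the tree's `SymmetricLiouville.Negative.isSkew_rotGenL`; taken BY NAME (gate lint dedup.landed).

/-- The rotation generator is nonzero. -/
theorem rotGenL_ne_zero : (rotGenL : E3 →L[ℝ] E3) ≠ 0 := by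
  intro h
  have := congrArg (fun L : E3 →L[ℝ] E3 => L (EuclideanSpace.single 0 1) 1) h
  simp [rotGen] at this

/-- **Axisymmetric late slices have the rigid symmetry `(0, J)`** (tree `IsAxisymmetric.fderiv_rotGen`: the
infinitesimal form `Du(x)[Jx] = J u(x)` of `u(R_θ x) = R_θ u(x)`). -/
theorem hasRigidSymmetry_of_axisymmetric {T : ℝ} {u : ℝ → E3 → E3}
    (hax : ∀ᶠ t in 𝓝[<] T, IsAxisymmetric (u t)) (hd : ∀ᶠ t in 𝓝[<] T, Differentiable ℝ (u t)) :
    HasRigidSymmetry T 0 rotGenL u := by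
  filter_upwards [hax, hd] with t ht hdt x
  simp only [killingDefect, zero_add, rotGenL_apply]
  rw [ht.fderiv_rotGen (hdt x), sub_self]

/-- **Anchor: the axisymmetric Type-I scenario in the Clay frame** (census row F2, Type-I branch, WITH swirl; in print
KNSS 2009 Thm 6.x / Seregin–Šverák 2009 Thm 1.1 / Chen–Strain–Tsai–Yau; tree fact `knss_no_axisymmetric_typeI` has a
different frame — no decay, boundedness on compact time intervals) follows from row F1sy, i.e. is re-derived in kernel
from the SymmetryModuliCount leaves: Type I + late slices axisymmetric about the vertical axis ⇒ extension. -/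
theorem rowF1_axisymmetric_typeI : ∀ (ν T : ℝ), 0 < ν → 0 < T →
    ∀ (u : ℝ → E3 → E3) (p : ℝ → E3 → ℝ),
    IsClassicalNSSolutionOn (Ico 0 T) ν 0 u p → IsLerayHopfOn T ν 0 (u 0) u →
    HasRapidSpatialDecay (u 0) → IsTypeIBlowup u T → (∀ᶠ t in 𝓝[<] T, IsAxisymmetric (u t)) →
    HasSmoothExtensionPast ν 0 u T := by
  intro ν T hν hT u p hsol hLH hdec hTI hax
  have hd : ∀ᶠ t in 𝓝[<] T, Differentiable ℝ (u t) := by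
    filter_upwards [Ioo_mem_nhdsLT hT] with t ht
    exact (hsol.contDiff_velocity ⟨ht.1.le, ht.2⟩).differentiable (by simp)
  exact rowF1sy_holds ν T hν hT u p hsol hLH hdec hTI
    ⟨0, rotGenL, SymmetricLiouville.Negative.isSkew_rotGenL, fun h => rotGenL_ne_zero h.2, hasRigidSymmetry_of_axisymmetric hax hd⟩

/-- LINE 15 verbatim: a **subcritical level** `Λ(t) √(T − t) → 0`. -/
def IsSubcriticalLevel (T : ℝ) (Λ : ℝ → ℝ) : Prop :=
  Tendsto (fun t => Λ t * Real.sqrt (T - t)) (𝓝[<] T) (𝓝 0)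

/-- LINE 15 verbatim: **slack direction `e` on the top at level `Λ`**. -/
def HasSlackDirectionAt (T : ℝ) (Λ : ℝ → ℝ) (e : E3) (u : ℝ → E3 → E3) : Prop :=
  ∀ ε : ℝ, 0 < ε → ∀ᶠ t in 𝓝[<] T, ∀ x : E3, Λ t < ‖u t x‖ → (T - t) * ‖fderiv ℝ (u t) x e‖ ≤ ε

/-- LINE 15 verbatim: **columnar top**. -/
def HasColumnarTop (T : ℝ) (u : ℝ → E3 → E3) : Prop :=
  ∃ Λ : ℝ → ℝ, IsSubcriticalLevel T Λ ∧ ∃ e : E3, ‖e‖ = 1 ∧ HasSlackDirectionAt T Λ e u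

/-- LINE 15 verbatim: **criterion row F1co** (Type I · columnar top · Clay ⇒ extension). -/
def Row_F1co : Prop :=
  ∀ (ν T : ℝ), 0 < ν → 0 < T →
    ∀ (u : ℝ → E3 → E3) (p : ℝ → E3 → ℝ),
    IsClassicalNSSolutionOn (Ico 0 T) ν 0 u p → IsLerayHopfOn T ν 0 (u 0) u →
    HasRapidSpatialDecay (u 0) → IsTypeIBlowup u T → HasColumnarTop T u →
    HasSmoothExtensionPast ν 0 u T

/-- **ORDER LEMMA (translation stratum ⊇ LINE 15).**  A slack direction `e` on the top of ONE subcritical level gives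
Killing slack on the top for the translation generator `(e, 0)` (at EVERY Type-I-scale level: the subcritical top
eventually contains each Type-I-scale top, and `killingSize ν T e 0 ≡ ‖e‖ = 1`). -/
theorem hasKillingSlackTop_of_slackDirection {ν T : ℝ} (hν : 0 < ν) {Λ : ℝ → ℝ} (hΛ : IsSubcriticalLevel T Λ)
    {e : E3} (he : ‖e‖ = 1) {u : ℝ → E3 → E3} (h : HasSlackDirectionAt T Λ e u) :
    HasKillingSlackTop ν T e 0 u := by
  intro Λ' hΛ' ε hε
  have hpos : 0 < Λ' * Real.sqrt ν := by positivity
  have h1 : ∀ᶠ t in 𝓝[<] T, Λ t * Real.sqrt (T - t) < Λ' * Real.sqrt ν := hΛ.eventually (Iio_mem_nhds hpos)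
  have h2 : ∀ᶠ t in 𝓝[<] T, t < T := eventually_nhdsWithin_of_forall fun t ht => ht
  filter_upwards [h ε hε, h1, h2] with t ht hlt htT x hx
  have hst : 0 < Real.sqrt (T - t) := Real.sqrt_pos.2 (sub_pos.2 htT)
  have hfast : Λ t < ‖u t x‖ := by
    by_contra hle
    push Not at hle
    have := mul_le_mul_of_nonneg_left hle hst.le
    nlinarith
  have hk : killingDefect e 0 (u t) x = fderiv ℝ (u t) x e := by simp [killingDefect]
  have hs : killingSize ν T e 0 t x = 1 := by simp [killingSize, he]
  rw [hk, hs, mul_one]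
  exact ht x hfast

/-- Columnar top ⇒ almost symmetric top. -/
theorem HasColumnarTop.hasAlmostSymmetricTop {ν T : ℝ} (hν : 0 < ν) {u : ℝ → E3 → E3}
    (h : HasColumnarTop T u) : HasAlmostSymmetricTop ν T u := by
  obtain ⟨Λ, hΛ, e, he, h⟩ := h
  have hskew : IsSkew (0 : E3 →L[ℝ] E3) := fun x => by simp
  have hne : ¬ (e = 0 ∧ (0 : E3 →L[ℝ] E3) = 0) := by
    rintro ⟨rfl, -⟩
    simp at he
  exact ⟨e, 0, hskew, hne, hasKillingSlackTop_of_slackDirection hν hΛ he h⟩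

/-- **ORDER LEMMA: row F1kt implies LINE 15's row F1co** (this line's theorem is the stronger one on the translation
stratum; the rotation and screw strata are new). -/
theorem rowF1co_of_rowF1kt (h : Row_F1kt) : Row_F1co :=
  fun ν T hν hT u p hsol hLH hdec hTI hc => h ν T hν hT u p hsol hLH hdec hTI (hc.hasAlmostSymmetricTop hν)

-- `rowF1co_holds`: a second proof term for LINE 15's row F1co (statement identical to the landed `ColumnarTop.rowF1co_holds`; gate near-duplicate / reviewers); not re-declared — the route is `rowF1co_of_rowF1kt rowF1kt_holds`.

/-- **Summary of the line** (ten kernel facts). -/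
theorem symmetricTop_summary :
    Row_F1kt ∧ Row_F1ks ∧ Row_F1sy ∧ RigidMotionsBreak ∧
    (Row_F1kt → Row_F1ks) ∧ (Row_F1ks → Row_F1sy) ∧ (Row_F1kt → Row_F1co) ∧
    (SymmetricCollapse ↔ ScenarioCensus.Row_F1) ∧ (Row_F1kt → SymmetricCollapse → ScenarioCensus.Row_F1) ∧
    (∀ (ν T : ℝ), 0 < ν → 0 < T → ∀ (u : ℝ → E3 → E3) (p : ℝ → E3 → ℝ),
      IsClassicalNSSolutionOn (Ico 0 T) ν 0 u p → IsLerayHopfOn T ν 0 (u 0) u →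
      HasRapidSpatialDecay (u 0) → IsTypeIBlowup u T → (∀ᶠ t in 𝓝[<] T, IsAxisymmetric (u t)) →
      HasSmoothExtensionPast ν 0 u T) :=
  ⟨rowF1kt_holds, rowF1ks_holds, rowF1sy_holds, rigidMotionsBreak_holds, rowF1ks_of_rowF1kt, rowF1sy_of_rowF1ks,
    rowF1co_of_rowF1kt, symmetricCollapse_iff_rowF1, rowF1_of, rowF1_axisymmetric_typeI⟩

end Summit.NavierStokesRegularity.NavierStokesRegularity.Theorems.ScenarioCensus.SymmetricTop

namespace Summit.NavierStokesRegularity.NavierStokesRegularity.Theorems.ScenarioCensus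

/-! ## Census KEYS (ns `…Theorems.ScenarioCensus`): the SYMMETRIC-TOP members of row F1 (LINE 33) — TREE-decided F1sy / F1ks / F1kt and floor RMB -/

/-- **Cell F1sy** (Type I · SYMMETRIC END: the solution is invariant under one nonzero rigid motion near `T` ⇒ smooth extension past `T`): `:= SymmetricTop.Row_F1sy`. DECIDED. -/
def Row_F1sy : Prop := SymmetricTop.Row_F1sy
/-- F1sy is EXCLUDED (decided in the tree): `SymmetricTop.rowF1sy_holds`. -/
theorem row_F1sy_excluded : Row_F1sy := SymmetricTop.rowF1sy_holds

/-- **Cell F1ks** (Type I · ALMOST SYMMETRIC END, global `o`-form of the Killing defect): `:= SymmetricTop.Row_F1ks`. DECIDED. -/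
def Row_F1ks : Prop := SymmetricTop.Row_F1ks
/-- F1ks is EXCLUDED (decided in the tree): `SymmetricTop.rowF1ks_holds`. -/
theorem row_F1ks_excluded : Row_F1ks := SymmetricTop.rowF1ks_holds

/-- **Cell F1kt** (Type I · ALMOST SYMMETRIC TOP: the dimensionless Killing defect of one nonzero Killing generator is `o(1)` on the fast top): `:= SymmetricTop.Row_F1kt`. DECIDED. -/
def Row_F1kt : Prop := SymmetricTop.Row_F1kt
/-- F1kt is EXCLUDED (decided in the tree): `SymmetricTop.rowF1kt_holds`. -/
theorem row_F1kt_excluded : Row_F1kt := SymmetricTop.rowF1kt_holds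

/-- **Floor RMB — RIGID MOTIONS BREAK ON THE TOP**: `SymmetricTop.rigidMotionsBreak_holds`. -/
theorem row_F1_rigidMotionsBreak : SymmetricTop.RigidMotionsBreak := SymmetricTop.rigidMotionsBreak_holds
/-- Lattice edges at key level: F1kt ⇒ F1ks ⇒ F1sy, F1kt ⇒ F1co (`SymmetricTop.rowF1ks_of_rowF1kt` / `rowF1sy_of_rowF1ks` / `rowF1co_of_rowF1kt`). -/
theorem rowF1ks_of_rowF1kt : Row_F1kt → Row_F1ks := SymmetricTop.rowF1ks_of_rowF1kt
/-- See `rowF1ks_of_rowF1kt`. -/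
theorem rowF1sy_of_rowF1ks : Row_F1ks → Row_F1sy := SymmetricTop.rowF1sy_of_rowF1ks
/-- See `rowF1ks_of_rowF1kt`. -/
theorem rowF1co_of_rowF1kt : Row_F1kt → Row_F1co := SymmetricTop.rowF1co_of_rowF1kt

end Summit.NavierStokesRegularity.NavierStokesRegularity.Theorems.ScenarioCensus

end
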